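import Summits.ResolutionOfSingularities.ResolutionOfSingularities.Theorems.PurelyInseparableDim4JointLeafComputations
import HarnessLib

/-!
# Purely inseparable four-folds: the POINT blow-up of `z^p + Q`, `Q = x₁^p x₂ + x₂^p x₃ + x₃^p x₄ + x₄^p x₁`, has no equimultiple
# point (`p ≥ 3`) — the leaf of part 24a needs no further blow-up (brick S3 (c) «joint point∘coordinate chains», part 24b,
# cell `res-dim4-pi`)

[OURS · counted 0] (D-0157 DOOR 2; desk WORD #66 (4)(c), #74 (g), #99 (d); frame `PIDim4.TerminationImpliesOrderReduction`,
S3 (c); host item stmt-ResolutionOfSingularities-16155, helper). Nothing here proves resolution of singularities in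
dimension ≥ 4 / characteristic `p` — NOT here, not anywhere in this programme.

On the `y_k`-chart of the blow-up of the origin, `Q` transforms to `y_k · R_k` with `R_k = y_{k+1} + y_{k+1}^p y_{k+2} + y_{k+2}^p y_{k+3}
+ y_{k+3}^p` (indices mod 4; `chartTransform_Q_zero/one/two/three`); the coefficient of `y_k y_{k+1}` in `Q′_k(y + b)` (`b_k = 0`) is
`(∂R_k/∂y_{k+1})(b) = 1` (`coeff_pair_translate_X_mul`), a monomial of degree `2 < p`: **`not_isEquimultiplePoint_Q`** — no pair
`(k, b)` with `b_k = 0` is equimultiple for `(Q, univ)`; hence the point walk from any state with `F = Q` is EMPTY (`not_edge_of_F_eq_Q`,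
`acc_edge_of_F_eq_Q`, `finite_pairs_of_reflTransGen_of_F_eq_Q`). The certificate is part 24c.

AI-produced formalisation, weaker than expert review. bears_on: LADDER-RESOLUTION:D157-DOOR2 (res-dim4-pi · S3 (c) joint v2 · leaf
instance, point charts).
-/

set_option linter.dupNamespace false -- D-0017: single-problem summit path `Summit.<S>.<S>.…` by design

noncomputable section

open MvPolynomial Finset CategoryTheory AlgebraicGeometry Opposite TopologicalSpace

namespace Summit.ResolutionOfSingularities.ResolutionOfSingularities.Theorems.PIDim4

open Literature.AlgebraicGeometry.Resolution
open Literature.AlgebraicGeometry.Resolution.Hauser2010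
open Literature.AlgebraicGeometry.Resolution.AffinePointBlowup (P A γ coord Wtop ξ)

namespace Equimultiple

section Instance₆Point

variable {K : Type} [Field K] {p : ℕ} [hp : Fact p.Prime] [CharP K p]

/-! ## §1 The four charts of the point blow-up of `Q` -/

omit hp [CharP K p] in
/-- Degrees of the four exponents of `Q` (for the point chart law). [folklore] -/
theorem degIn_univ_Q (a c : Fin 4) : CentreBlowup.degIn (Finset.univ : Finset (Fin 4))
    (Finsupp.single a p + Finsupp.single c 1) = p + 1 := by
  rw [CentreBlowup.degIn_univ, map_add, Finsupp.degree_single, Finsupp.degree_single]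

omit hp [CharP K p] in
/-- **The `y₁`-chart of the point blow-up of `Q` reads `y₁ · (y₂ + y₂^p y₃ + y₃^p y₄ + y₄^p)`.** [folklore] -/
theorem chartTransform_Q_zero :
    CentreBlowup.chartTransform p (Finset.univ : Finset (Fin 4)) 0
        (X 0 ^ p * X 1 + X 1 ^ p * X 2 + X 2 ^ p * X 3 + X 3 ^ p * X 0 : MvPolynomial (Fin 4) K) =
      X 0 * (X 1 + X 1 ^ p * X 2 + X 2 ^ p * X 3 + X 3 ^ p) := by
  rw [Q_eq_monomial_add, CentreBlowup.chartTransform_add, CentreBlowup.chartTransform_add,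
    CentreBlowup.chartTransform_monomial_add_monomial, CentreBlowup.chartTransform_monomial, CentreBlowup.chartTransform_monomial]
  simp only [CentreBlowup.chartExponent, degIn_univ_Q]
  have e1 : (Finsupp.single 0 p + Finsupp.single 1 1 : Fin 4 →₀ ℕ).update 0 (p + 1 - p) = Finsupp.single 0 1 + Finsupp.single 1 1 := by
    ext i; fin_cases i <;> simp [Finsupp.update_apply]
  have e2 : (Finsupp.single 1 p + Finsupp.single 2 1 : Fin 4 →₀ ℕ).update 0 (p + 1 - p) =
      Finsupp.single 0 1 + (Finsupp.single 1 p + Finsupp.single 2 1) := by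
    ext i; fin_cases i <;> simp [Finsupp.update_apply]
  have e3 : (Finsupp.single 2 p + Finsupp.single 3 1 : Fin 4 →₀ ℕ).update 0 (p + 1 - p) =
      Finsupp.single 0 1 + (Finsupp.single 2 p + Finsupp.single 3 1) := by
    ext i; fin_cases i <;> simp [Finsupp.update_apply]
  have e4 : (Finsupp.single 3 p + Finsupp.single 0 1 : Fin 4 →₀ ℕ).update 0 (p + 1 - p) = Finsupp.single 0 1 + Finsupp.single 3 p := by
    ext i; fin_cases i <;> simp [Finsupp.update_apply]
  have h₁ : (monomial (Finsupp.single 0 1 + Finsupp.single 1 1) (1 : K) : MvPolynomial (Fin 4) K) = X 0 * X 1 := by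
    rw [X, X, monomial_mul, mul_one]
  have h₂ : (monomial (Finsupp.single 0 1 + (Finsupp.single 1 p + Finsupp.single 2 1)) (1 : K) : MvPolynomial (Fin 4) K) =
      X 0 * (X 1 ^ p * X 2) := by
    rw [X_pow_mul_X_eq_monomial, X, monomial_mul, mul_one]
  have h₃ : (monomial (Finsupp.single 0 1 + (Finsupp.single 2 p + Finsupp.single 3 1)) (1 : K) : MvPolynomial (Fin 4) K) =
      X 0 * (X 2 ^ p * X 3) := by
    rw [X_pow_mul_X_eq_monomial, X, monomial_mul, mul_one]
  have h₄ : (monomial (Finsupp.single 0 1 + Finsupp.single 3 p) (1 : K) : MvPolynomial (Fin 4) K) = X 0 * X 3 ^ p := by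
    rw [X_pow_eq_monomial, X, monomial_mul, mul_one]
  rw [e1, e2, e3, e4, h₁, h₂, h₃, h₄]
  ring


omit hp [CharP K p] in
/-- **The `y₂`-chart of the point blow-up of `Q` reads `y₂ · (y₃ + y₃^p y₄ + y₄^p y₁ + y₁^p)`.** [folklore] -/
theorem chartTransform_Q_one :
    CentreBlowup.chartTransform p (Finset.univ : Finset (Fin 4)) 1
        (X 0 ^ p * X 1 + X 1 ^ p * X 2 + X 2 ^ p * X 3 + X 3 ^ p * X 0 : MvPolynomial (Fin 4) K) =
      X 1 * (X 2 + X 2 ^ p * X 3 + X 3 ^ p * X 0 + X 0 ^ p) := by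
  rw [Q_eq_monomial_add, CentreBlowup.chartTransform_add, CentreBlowup.chartTransform_add,
    CentreBlowup.chartTransform_monomial_add_monomial, CentreBlowup.chartTransform_monomial, CentreBlowup.chartTransform_monomial]
  simp only [CentreBlowup.chartExponent, degIn_univ_Q]
  have e1 : (Finsupp.single 0 p + Finsupp.single 1 1 : Fin 4 →₀ ℕ).update 1 (p + 1 - p) = Finsupp.single 1 1 + Finsupp.single 0 p := by
    ext i; fin_cases i <;> simp [Finsupp.update_apply]
  have e2 : (Finsupp.single 1 p + Finsupp.single 2 1 : Fin 4 →₀ ℕ).update 1 (p + 1 - p) = Finsupp.single 1 1 + Finsupp.single 2 1 := by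
    ext i; fin_cases i <;> simp [Finsupp.update_apply]
  have e3 : (Finsupp.single 2 p + Finsupp.single 3 1 : Fin 4 →₀ ℕ).update 1 (p + 1 - p) =
      Finsupp.single 1 1 + (Finsupp.single 2 p + Finsupp.single 3 1) := by
    ext i; fin_cases i <;> simp [Finsupp.update_apply]
  have e4 : (Finsupp.single 3 p + Finsupp.single 0 1 : Fin 4 →₀ ℕ).update 1 (p + 1 - p) =
      Finsupp.single 1 1 + (Finsupp.single 3 p + Finsupp.single 0 1) := by
    ext i; fin_cases i <;> simp [Finsupp.update_apply]
  have h₁ : (monomial (Finsupp.single 1 1 + Finsupp.single 0 p) (1 : K) : MvPolynomial (Fin 4) K) = X 1 * X 0 ^ p := by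
    rw [X_pow_eq_monomial, X, monomial_mul, mul_one]
  have h₂ : (monomial (Finsupp.single 1 1 + Finsupp.single 2 1) (1 : K) : MvPolynomial (Fin 4) K) = X 1 * X 2 := by
    rw [X, X, monomial_mul, mul_one]
  have h₃ : (monomial (Finsupp.single 1 1 + (Finsupp.single 2 p + Finsupp.single 3 1)) (1 : K) : MvPolynomial (Fin 4) K) =
      X 1 * (X 2 ^ p * X 3) := by
    rw [X_pow_mul_X_eq_monomial, X, monomial_mul, mul_one]
  have h₄ : (monomial (Finsupp.single 1 1 + (Finsupp.single 3 p + Finsupp.single 0 1)) (1 : K) : MvPolynomial (Fin 4) K) =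
      X 1 * (X 3 ^ p * X 0) := by
    rw [X_pow_mul_X_eq_monomial, X, monomial_mul, mul_one]
  rw [e1, e2, e3, e4, h₁, h₂, h₃, h₄]
  ring

omit hp [CharP K p] in
/-- **The `y₃`-chart of the point blow-up of `Q` reads `y₃ · (y₄ + y₄^p y₁ + y₁^p y₂ + y₂^p)`.** [folklore] -/
theorem chartTransform_Q_two :
    CentreBlowup.chartTransform p (Finset.univ : Finset (Fin 4)) 2
        (X 0 ^ p * X 1 + X 1 ^ p * X 2 + X 2 ^ p * X 3 + X 3 ^ p * X 0 : MvPolynomial (Fin 4) K) =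
      X 2 * (X 3 + X 3 ^ p * X 0 + X 0 ^ p * X 1 + X 1 ^ p) := by
  rw [Q_eq_monomial_add, CentreBlowup.chartTransform_add, CentreBlowup.chartTransform_add,
    CentreBlowup.chartTransform_monomial_add_monomial, CentreBlowup.chartTransform_monomial, CentreBlowup.chartTransform_monomial]
  simp only [CentreBlowup.chartExponent, degIn_univ_Q]
  have e1 : (Finsupp.single 0 p + Finsupp.single 1 1 : Fin 4 →₀ ℕ).update 2 (p + 1 - p) =
      Finsupp.single 2 1 + (Finsupp.single 0 p + Finsupp.single 1 1) := by
    ext i; fin_cases i <;> simp [Finsupp.update_apply]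
  have e2 : (Finsupp.single 1 p + Finsupp.single 2 1 : Fin 4 →₀ ℕ).update 2 (p + 1 - p) = Finsupp.single 2 1 + Finsupp.single 1 p := by
    ext i; fin_cases i <;> simp [Finsupp.update_apply]
  have e3 : (Finsupp.single 2 p + Finsupp.single 3 1 : Fin 4 →₀ ℕ).update 2 (p + 1 - p) = Finsupp.single 2 1 + Finsupp.single 3 1 := by
    ext i; fin_cases i <;> simp [Finsupp.update_apply]
  have e4 : (Finsupp.single 3 p + Finsupp.single 0 1 : Fin 4 →₀ ℕ).update 2 (p + 1 - p) =
      Finsupp.single 2 1 + (Finsupp.single 3 p + Finsupp.single 0 1) := by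
    ext i; fin_cases i <;> simp [Finsupp.update_apply]
  have h₁ : (monomial (Finsupp.single 2 1 + (Finsupp.single 0 p + Finsupp.single 1 1)) (1 : K) : MvPolynomial (Fin 4) K) =
      X 2 * (X 0 ^ p * X 1) := by
    rw [X_pow_mul_X_eq_monomial, X, monomial_mul, mul_one]
  have h₂ : (monomial (Finsupp.single 2 1 + Finsupp.single 1 p) (1 : K) : MvPolynomial (Fin 4) K) = X 2 * X 1 ^ p := by
    rw [X_pow_eq_monomial, X, monomial_mul, mul_one]
  have h₃ : (monomial (Finsupp.single 2 1 + Finsupp.single 3 1) (1 : K) : MvPolynomial (Fin 4) K) = X 2 * X 3 := by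
    rw [X, X, monomial_mul, mul_one]
  have h₄ : (monomial (Finsupp.single 2 1 + (Finsupp.single 3 p + Finsupp.single 0 1)) (1 : K) : MvPolynomial (Fin 4) K) =
      X 2 * (X 3 ^ p * X 0) := by
    rw [X_pow_mul_X_eq_monomial, X, monomial_mul, mul_one]
  rw [e1, e2, e3, e4, h₁, h₂, h₃, h₄]
  ring

omit hp [CharP K p] in
/-- **The `y₄`-chart of the point blow-up of `Q` reads `y₄ · (y₁ + y₁^p y₂ + y₂^p y₃ + y₃^p)`.** [folklore] -/
theorem chartTransform_Q_three :
    CentreBlowup.chartTransform p (Finset.univ : Finset (Fin 4)) 3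
        (X 0 ^ p * X 1 + X 1 ^ p * X 2 + X 2 ^ p * X 3 + X 3 ^ p * X 0 : MvPolynomial (Fin 4) K) =
      X 3 * (X 0 + X 0 ^ p * X 1 + X 1 ^ p * X 2 + X 2 ^ p) := by
  rw [Q_eq_monomial_add, CentreBlowup.chartTransform_add, CentreBlowup.chartTransform_add,
    CentreBlowup.chartTransform_monomial_add_monomial, CentreBlowup.chartTransform_monomial, CentreBlowup.chartTransform_monomial]
  simp only [CentreBlowup.chartExponent, degIn_univ_Q]
  have e1 : (Finsupp.single 0 p + Finsupp.single 1 1 : Fin 4 →₀ ℕ).update 3 (p + 1 - p) =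
      Finsupp.single 3 1 + (Finsupp.single 0 p + Finsupp.single 1 1) := by
    ext i; fin_cases i <;> simp [Finsupp.update_apply]
  have e2 : (Finsupp.single 1 p + Finsupp.single 2 1 : Fin 4 →₀ ℕ).update 3 (p + 1 - p) =
      Finsupp.single 3 1 + (Finsupp.single 1 p + Finsupp.single 2 1) := by
    ext i; fin_cases i <;> simp [Finsupp.update_apply]
  have e3 : (Finsupp.single 2 p + Finsupp.single 3 1 : Fin 4 →₀ ℕ).update 3 (p + 1 - p) = Finsupp.single 3 1 + Finsupp.single 2 p := by
    ext i; fin_cases i <;> simp [Finsupp.update_apply]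
  have e4 : (Finsupp.single 3 p + Finsupp.single 0 1 : Fin 4 →₀ ℕ).update 3 (p + 1 - p) = Finsupp.single 3 1 + Finsupp.single 0 1 := by
    ext i; fin_cases i <;> simp [Finsupp.update_apply]
  have h₁ : (monomial (Finsupp.single 3 1 + (Finsupp.single 0 p + Finsupp.single 1 1)) (1 : K) : MvPolynomial (Fin 4) K) =
      X 3 * (X 0 ^ p * X 1) := by
    rw [X_pow_mul_X_eq_monomial, X, monomial_mul, mul_one]
  have h₂ : (monomial (Finsupp.single 3 1 + (Finsupp.single 1 p + Finsupp.single 2 1)) (1 : K) : MvPolynomial (Fin 4) K) =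
      X 3 * (X 1 ^ p * X 2) := by
    rw [X_pow_mul_X_eq_monomial, X, monomial_mul, mul_one]
  have h₃ : (monomial (Finsupp.single 3 1 + Finsupp.single 2 p) (1 : K) : MvPolynomial (Fin 4) K) = X 3 * X 2 ^ p := by
    rw [X_pow_eq_monomial, X, monomial_mul, mul_one]
  have h₄ : (monomial (Finsupp.single 3 1 + Finsupp.single 0 1) (1 : K) : MvPolynomial (Fin 4) K) = X 3 * X 0 := by
    rw [X, X, monomial_mul, mul_one]
  rw [e1, e2, e3, e4, h₁, h₂, h₃, h₄]
  ring

/-! ## §2 No equimultiple point -/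

omit hp [CharP K p] in
/-- **The coefficient of `y_k y_l` in `(y_k · R)(y + b)` is `(∂R/∂y_l)(b)` when `b_k = 0`.** [folklore] -/
theorem coeff_pair_translate_X_mul (k l : Fin 4) (b : Fin 4 → K) (hbk : b k = 0) (R : MvPolynomial (Fin 4) K) :
    coeff (Finsupp.single k 1 + Finsupp.single l 1) (PointBlowup.translate b (X k * R)) = eval b (pderiv l R) := by
  have htr : PointBlowup.translate b (X k * R) = X k * PointBlowup.translate b R := by
    unfold PointBlowup.translate
    rw [map_mul, aeval_X, hbk, C_0, add_zero]
  rw [htr, coeff_X_mul', if_pos (by simp), show Finsupp.single k 1 + Finsupp.single l 1 - Finsupp.single k 1 =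
    Finsupp.single l 1 from add_tsub_cancel_left _ _, coeff_single_one_translate]

omit hp in
/-- **NO PAIR `(k, b)` WITH `b_k = 0` IS EQUIMULTIPLE FOR `(Q, univ)` when `p ≥ 3`**: the monomial `y_k y_{k+1}` of degree `2 < p`
has coefficient `1` in the translated chart transform. [cite: Hauser2010, §F (equiconstant points)] -/
theorem not_isEquimultiplePoint_Q [DecidableEq K] (hp3 : 3 ≤ p) (k : Fin 4) (b : Fin 4 → K) (hbk : b k = 0)
    (s : State K) (hs : s.F = X 0 ^ p * X 1 + X 1 ^ p * X 2 + X 2 ^ p * X 3 + X 3 ^ p * X 0) :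
    ¬ CentreBlowup.IsEquimultiplePoint p (Finset.univ : Finset (Fin 4)) k b s := by
  intro h
  unfold CentreBlowup.IsEquimultiplePoint CentreBlowup.pointTransform at h
  rw [hs] at h
  have hdeg : ∀ l : Fin 4, (Finsupp.single k 1 + Finsupp.single l 1 : Fin 4 →₀ ℕ).degree < p := fun l => by
    rw [map_add, Finsupp.degree_single, Finsupp.degree_single]; omega
  have hne : ∀ l : Fin 4, (Finsupp.single k 1 + Finsupp.single l 1 : Fin 4 →₀ ℕ) ≠ 0 := fun l h0 => by
    have := DFunLike.congr_fun h0 k; simp at this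
  obtain rfl | rfl | rfl | rfl : k = 0 ∨ k = 1 ∨ k = 2 ∨ k = 3 := by fin_cases k <;> simp
  · have h1 := h _ (hne 1) (hdeg 1)
    rw [chartTransform_Q_zero, coeff_pair_translate_X_mul 0 1 b hbk] at h1
    simp [(pderiv (1 : Fin 4)).leibniz_pow] at h1
  · have h1 := h _ (hne 2) (hdeg 2)
    rw [chartTransform_Q_one, coeff_pair_translate_X_mul 1 2 b hbk] at h1
    simp [(pderiv (2 : Fin 4)).leibniz_pow] at h1
  · have h1 := h _ (hne 3) (hdeg 3)
    rw [chartTransform_Q_two, coeff_pair_translate_X_mul 2 3 b hbk] at h1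
    simp [(pderiv (3 : Fin 4)).leibniz_pow] at h1
  · have h1 := h _ (hne 0) (hdeg 0)
    rw [chartTransform_Q_three, coeff_pair_translate_X_mul 3 0 b hbk] at h1
    simp [(pderiv (0 : Fin 4)).leibniz_pow] at h1

omit hp in
/-- **The point walk from a state with `F = Q` is empty**: no edge. [cite: Hauser2010, §F] -/
theorem not_edge_of_F_eq_Q [DecidableEq K] (hp3 : 3 ≤ p) (s s' : State K)
    (hs : s.F = X 0 ^ p * X 1 + X 1 ^ p * X 2 + X 2 ^ p * X 3 + X 3 ^ p * X 0) : ¬ Edge p Finset.univ s s' := by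
  rintro ⟨k, b, -, hbk, heq, -, -⟩
  exact not_isEquimultiplePoint_Q hp3 k b hbk s hs heq

omit hp in
/-- Hence the flipped edge relation is accessible at such a state (vacuously). [folklore] -/
theorem acc_edge_of_F_eq_Q [DecidableEq K] (hp3 : 3 ≤ p) (s : State K)
    (hs : s.F = X 0 ^ p * X 1 + X 1 ^ p * X 2 + X 2 ^ p * X 3 + X 3 ^ p * X 0) :
    Acc (fun s' s : State K => Edge p Finset.univ s s') s :=
  Acc.intro _ fun s' he => absurd he (not_edge_of_F_eq_Q hp3 s s' hs)

omit hp in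
/-- And every state reachable by edges from it (only itself) has finitely many (namely no) equimultiple pairs. [folklore] -/
theorem finite_pairs_of_reflTransGen_of_F_eq_Q [DecidableEq K] (hp3 : 3 ≤ p) (s : State K)
    (hs : s.F = X 0 ^ p * X 1 + X 1 ^ p * X 2 + X 2 ^ p * X 3 + X 3 ^ p * X 0) (s' : State K)
    (hs' : Relation.ReflTransGen (fun a e : State K => Edge p Finset.univ a e) s s') :
    {jb : Fin 4 × (Fin 4 → K) | jb.2 jb.1 = 0 ∧ CentreBlowup.IsEquimultiplePoint p Finset.univ jb.1 jb.2 s'}.Finite := by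
  have hss : s' = s := by
    induction hs' with
    | refl => rfl
    | tail _ he ih => subst ih; exact absurd he (not_edge_of_F_eq_Q hp3 _ _ hs)
  subst hss
  refine Set.finite_empty.subset ?_
  rintro ⟨k, b⟩ ⟨hbk, heq⟩
  exact not_isEquimultiplePoint_Q hp3 k b hbk _ hs heq

end Instance₆Point

end Equimultiple

end Summit.ResolutionOfSingularities.ResolutionOfSingularities.Theorems.PIDim4

end
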